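import Summits.NavierStokesRegularity.NavierStokesRegularity.Theses.ExtremiserTransience
import HarnessLib

/-!
# Route `ExtremiserTransience` — the two D-0145 lines of seat ns-idea-5 g5 («extremal-example mining») are REDUCTIONS BY PURE LOGIC

`--supports stmt-NavierStokesRegularity-27697` (the glue item `TangentOfSheet` of the split of `TangentExtremalExtraction`, 26568).

This file contains no analysis.  It records, kernel-checked against the route file (rev 18), that
* LINE g5-β «quantum sheet»: `TangentOfSheet` (item 27697: `NoQuantumSheet → SheetOrTangent → TangentExtremalExtraction`) HOLDS —
  `SheetOrTangent` (27696) is by definition the dichotomy «26568's exact-extremal finite-enstrophy tangent object ∨ ¬NoQuantumSheet», so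
  with `NoQuantumSheet` (27695) the second branch is absurd (`tangentOfSheet`); and hence, with `NoExtremalAncient` (26569), the crux
  `NearExtremalTransiencePerFlow` (26567) follows from the two β-items (`netpf_of_sheet`);
* LINE g5-α «plateau transfer»: `LocalNearPlateauStability` (27676) → `PlateauTransfer` (27677) → `PlateauAncientRigidity` (27678) →
  `NearExtremalTransiencePerFlow` (26567) (`netpf_of_plateau`): the transfer produces, for a Type-I singular flow failing the per-flow
  certificate, a tangent plateau element, which the rigidity item forbids.
So after this file the OPEN content of the two lines is exactly {27695, 27696} resp. {27676, 27677, 27678}; the route's `closes` is unchanged.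
HONEST FRAMING: implications between OPEN statements about hypothetical Type-I singular flows and their blow-up limits; nothing about
Navier–Stokes regularity or blow-up is proved here, and no summit is proved by a line. [folklore]
-/

namespace Summit.NavierStokesRegularity.NavierStokesRegularity.Theses.ExtremiserTransience
set_option linter.dupNamespace false

/-- LINE g5-β: the glue item `TangentOfSheet` (stmt-NavierStokesRegularity-27697) — by cases on the dichotomy `SheetOrTangent`. -/
theorem tangentOfSheet : TangentOfSheet := by
  intro hN hS C ν T hC hν hT0 u p hcl hLH hdec hrate hnoext hno
  rcases hS C ν T hC hν hT0 u p hcl hLH hdec hrate hnoext hno with hA | hB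
  · exact hA
  · exact (hB hN).elim

/-- LINE g5-β, corollary: the two β-items and `NoExtremalAncient` (26569) give the crux `NearExtremalTransiencePerFlow` (26567). -/
theorem netpf_of_sheet (hN : NoQuantumSheet) (hS : SheetOrTangent) (hK : NoExtremalAncient) :
    NearExtremalTransiencePerFlow := by
  intro C ν T hC hν hT0 u p hcl hLH hdec hrate hnoext
  by_contra hno
  exact hK (tangentOfSheet hN hS C ν T hC hν hT0 u p hcl hLH hdec hrate hnoext hno)

/-- LINE g5-α: the three α-items give the crux `NearExtremalTransiencePerFlow` (26567). -/
theorem netpf_of_plateau (hL : LocalNearPlateauStability) (hT : PlateauTransfer) (hR : PlateauAncientRigidity) :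
    NearExtremalTransiencePerFlow := by
  intro C ν T hC hν hT0 u p hcl hLH hdec hrate hnoext
  by_contra hno
  exact hR (hT hL C ν T hC hν hT0 u p hcl hLH hdec hrate hnoext hno)

end Summit.NavierStokesRegularity.NavierStokesRegularity.Theses.ExtremiserTransience
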